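import Literature.Computability.MetaComplexity.CircuitMagnification
import Literature.Computability.MetaComplexity.MCSPProofs
import Literature.Computability.Complexity.PolyAdvicePH
import Literature.Computability.Complexity.PPolyReductions
import HarnessLib

/-!
# Proof of McKay–Murray–Williams 2019, Theorem 1.4 (third bullet): `MckayMurrayWilliams2019_thm14_holds`

This file DISCHARGES the named fact `Literature.Computability.MetaComplexity.MckayMurrayWilliams2019_thm14`
(`CircuitMagnification.lean`): for every `s` with `s(n) ≥ n`, if `MCSP[s] ∉ SIZE(N · s(log₂ N)^c + c)`
for every `c`, then `NP ⊄ P/poly` (D. M. McKay, C. D. Murray, R. R. Williams, *Weak lower bounds on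
resource-bounded compression imply strong separations of complexity classes*, STOC 2019,
doi:10.1145/3313276.3316396, Thm. 1.4 third bullet, proof §5 p. 1224 via Lemma 3.1).

## The published proof and how it is mirrored

MMW prove the contrapositive: assume `NP ⊂ P/poly`.
1. Then the polynomial hierarchy collapses to `P/poly` (§5: "if `NP ⊂ C` then the entire polynomial
   hierarchy collapses to `C`"). TREE: `PH_subset_PPoly_of_NP_subset_PPoly` (`PolyAdvicePH.lean`); we use
   it in closure form — under `NP ⊆ P/poly`, `P/poly` is closed under polynomially bounded `∃`/`∀`
   (`MMW19.exists_mem_PPoly`, `MMW19.forall_mem_PPoly`).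
2. The intermediate problem Circuit-Min-Merge (§1.2, §2.1): given circuits `C₁, C₂` consistent with two
   adjacent intervals of the truth table, output the (canonically first) small circuit `C'` consistent
   with both; "computable in the polynomial-time hierarchy … by guessing a `C'`, checking for all inputs
   … and checking for all `C'' < C'`". HERE: circuits are *clean programs* of the tree's circuit-evaluation
   machine (`CircuitEval.lean`, `CircuitEvalPrograms.lean`: a clean program with `#TAB ≤ s` computes a
   function of `B₂`-complexity `≤ max s 1`, Theorem R `exists_circuit_evalFn`; conversely `progOf C`
   has `#TAB = |C|`), the consistency predicate `MMW19.VALID` is a `∀`-projection of a `P` language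
   assembled from the tree's `FP` bricks (`evalFn`, `cleanT`, `tabMarksT`, `onesFn`, `LenLe`), the
   extension language `MMW19.EXT = {⟨z, π⟩ | some valid program extends the prefix π}` is then in `P/poly`,
   and the canonical (lexicographically first) merge is extracted bit by bit (`MMW19.greedy`, the
   standard search-to-decision self-reduction) by a chain of `P/poly` look-ups (`CktSize` algebra of
   `CircuitComposition.lean`).
3. Lemma 3.1: a `d`-ary tree of Circuit-Min-Merge gates whose leaves span the `2ⁿ`-bit input, the root
   reporting whether a small consistent circuit exists. HERE with `d = 2` over the dyadic blocks
   `{y ++ a | y ∈ {0,1}^h}` (the vendored statement is depth-unrestricted, so the arity of the tree is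
   immaterial): `MMW19.nodeSem`, `2ʰ` leaves and `2ʰ - 1` merge nodes of `poly(s)` gates each
   (`MMW19.cktSize_nodeSem`), soundness/completeness `MMW19.nodeSem_sound`, `MMW19.nodeSem_complete`.
4. §5, third bullet: replacing each gate by its `poly(s(n))`-size circuit gives size `N · poly(s(n))`;
   HERE the polynomial is absorbed into `s(n)^c` for `n ≥ 2` (`s(n) ≥ n ≥ 2`), the lengths `N ≤ 2` are
   served by the universal circuit and non-powers of two by the constant circuit (`MCSP[s]` has no such
   strings), giving `MCSP[s] ∈ SIZE(N · s(⌊log₂ N⌋)^c + c)`.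

## References

* D. M. McKay, C. D. Murray, R. R. Williams, STOC 2019, 1215–1225, Thm. 1.4, Lemma 3.1, §4 (Stream-Merge),
  §5 (proof of Thm. 1.4).
* R. M. Karp, R. J. Lipton, STOC 1980 (self-reduction under `NP ⊆ P/poly`).
* S. Arora, B. Barak, *Computational Complexity* (2009), Thm. 2.18 (search to decision), Def. 6.5.
-/

noncomputable section

namespace Literature.Computability.MetaComplexity

open _root_.Computability Complexity Complexity.Classes Complexity.CircEval Complexity.Nondeterministic
open MCSPVerif

namespace MMW19

open scoped Classical

/-! ### 1. Closure of `P/poly` under bounded quantifiers when `NP ⊆ P/poly` -/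

/-- Under `NP ⊆ P/poly`: `∃ᵖ·(P/poly) ⊆ P/poly` (`∃ᵖ·(P/poly) ⊆ NP/poly ⊆ (P/poly)/poly = P/poly`;
Karp–Lipton 1980, §1; MMW 2019, §5 "the polynomial hierarchy collapses"). [cite: KarpLipton1980, §1] -/
theorem polyExists_PPoly_subset (hNP : NP ⊆ PPoly) : polyExists PPoly ⊆ PPoly :=
  polyExists_PPoly_subset_polyAdvice_NP.trans ((polyAdvice_mono hNP).trans polyAdvice_PPoly_subset_PPoly)

/-- Under `NP ⊆ P/poly`, a polynomially bounded existential projection of a `P/poly` language is in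
`P/poly`. [cite: KarpLipton1980, §1] -/
theorem exists_mem_PPoly (hNP : NP ⊆ PPoly) {M : Language Bool} (hM : M ∈ PPoly) (p : Polynomial ℕ) :
    ({x | ∃ y : List Bool, y.length ≤ p.eval x.length ∧ boolPair x y ∈ M} : Language Bool) ∈ PPoly :=
  polyExists_PPoly_subset hNP ⟨M, hM, p, fun _ => Iff.rfl⟩

/-- Transport of `P/poly`-membership along an equality of languages. [folklore] -/
theorem mem_PPoly_of_eq {L L' : Language Bool} (he : L = L') (hL : L ∈ PPoly) : L' ∈ PPoly := he ▸ hL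

/-- Under `NP ⊆ P/poly`, a polynomially bounded universal projection of a `P/poly` language is in
`P/poly` (complement, `co P/poly = P/poly`). [cite: KarpLipton1980, §1] -/
theorem forall_mem_PPoly (hNP : NP ⊆ PPoly) {M : Language Bool} (hM : M ∈ PPoly) (p : Polynomial ℕ) :
    ({x | ∀ y : List Bool, y.length ≤ p.eval x.length → boolPair x y ∈ M} : Language Bool) ∈ PPoly := by
  have h1 := compl_mem_PPoly (exists_mem_PPoly hNP (compl_mem_PPoly hM) p)
  have he : ({x | ∃ y : List Bool, y.length ≤ p.eval x.length ∧ boolPair x y ∈ Mᶜ} : Language Bool)ᶜ =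
      ({x | ∀ y : List Bool, y.length ≤ p.eval x.length → boolPair x y ∈ M} : Language Bool) := by
    refine Language.ext fun x => ?_
    change (¬ ∃ y : List Bool, y.length ≤ p.eval x.length ∧ boolPair x y ∉ M) ↔
      ∀ y : List Bool, y.length ≤ p.eval x.length → boolPair x y ∈ M
    push Not
    rfl
  exact mem_PPoly_of_eq he h1

/-! ### 2. Programs of the evaluation machine: padding, the leaf programs, even lengths -/

/-- `READ`-padding: `k` copies of the instruction `01` (a `READ` leaves the value stack unchanged).
[folklore] -/
def readPad : ℕ → List Bool
  | 0 => []
  | k + 1 => false :: true :: readPad k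

/-- Length of the padding. [folklore] -/
@[simp] theorem length_readPad (k : ℕ) : (readPad k).length = 2 * k := by
  induction k with
  | zero => rfl
  | succ k ih => simp [readPad, ih]; ring

/-- The padding is a clean program. [folklore] -/
@[simp] theorem isClean_readPad (k : ℕ) : isClean (readPad k) = true := by
  induction k with
  | zero => simp [readPad]
  | succ k ih => simp [readPad, ih]

/-- The padding has no table instruction. [folklore] -/
@[simp] theorem tabCount_readPad (k : ℕ) : tabCount (readPad k) = 0 := by
  induction k with
  | zero => simp [readPad]
  | succ k ih => simp [readPad, ih]

/-- Running the padding leaves the value stack and the auxiliary stack unchanged. [folklore] -/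
theorem vmSpec_readPad : ∀ (k : ℕ) (V T S : List Bool), ∃ S' : List Bool, ∀ D : List Bool,
    vmSpec (readPad k ++ D) V T S = vmSpec D V T S'
  | 0, V, T, S => ⟨S, fun D => rfl⟩
  | k + 1, [], T, S => by
    obtain ⟨S', hS'⟩ := vmSpec_readPad k [] T S
    exact ⟨S', fun D => by rw [readPad, List.cons_append, List.cons_append]; simp [vmSpec, hS']⟩
  | k + 1, a :: V, T, S => by
    obtain ⟨S', hS'⟩ := vmSpec_readPad k (a :: V) T (a :: S)
    exact ⟨S', fun D => by rw [readPad, List.cons_append, List.cons_append]; simp [vmSpec, hS']⟩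

/-- **The leaf program** for the bit `b`: the table instruction with constant table `b`, padded to
length `ℓ` (for even `ℓ ≥ 6`); it is clean, has one table instruction and answers `b` on every input.
[folklore] -/
def leafProg (ℓ : ℕ) (b : Bool) : List Bool :=
  tabCode b b b b ++ readPad ((ℓ - 6) / 2)

/-- The leaf program is clean. [folklore] -/
@[simp] theorem isClean_leafProg (ℓ : ℕ) (b : Bool) : isClean (leafProg ℓ b) = true := by
  rw [leafProg, isClean_append _ _ _ le_rfl (isClean_tabCode _ _ _ _), isClean_readPad]

/-- The leaf program has one table instruction. [folklore] -/
@[simp] theorem tabCount_leafProg (ℓ : ℕ) (b : Bool) : tabCount (leafProg ℓ b) = 1 := by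
  rw [leafProg, tabCount_append _ _ _ le_rfl (isClean_tabCode _ _ _ _), tabCount_readPad, tabCount_tabCode,
    Nat.add_zero]

/-- Length of the leaf program: `ℓ`, for even `ℓ ≥ 6`. [folklore] -/
theorem length_leafProg {ℓ : ℕ} (h6 : 6 ≤ ℓ) (he : 2 ∣ ℓ) (b : Bool) : (leafProg ℓ b).length = ℓ := by
  rw [leafProg, List.length_append, length_tabCode, length_readPad]
  obtain ⟨m, rfl⟩ := he
  omega

/-- **The leaf program answers `b`** on every input string. [folklore] -/
theorem evalFn_leafProg (ℓ : ℕ) (b : Bool) (w : List Bool) : evalFn (boolPair w (leafProg ℓ b)) = [b] := by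
  rw [evalFn_boolPair, leafProg]
  have htab : ∀ (D V T : List Bool), vmSpec (tabCode b b b b ++ D) V T [] = vmSpec D (b :: V) T [] := by
    intro D V T
    simp [tabCode, vmSpec, tabV, pickAt, sel, idxOf]
  rw [htab]
  obtain ⟨S', hS'⟩ := vmSpec_readPad ((ℓ - 6) / 2) (b :: layV [] w) [] []
  have := hS' []
  rw [List.append_nil] at this
  rw [this]
  simp [vmSpec]

/-- Gate codes have even length. [folklore] -/
theorem two_dvd_length_gateCode {n : ℕ} (j : ℕ) (g : Gate (Fin n)) : 2 ∣ (gateCode j g).length := by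
  rw [gateCode, List.length_append, List.length_append, length_readCode, length_readCode, length_tabCode]
  omega

/-- Codes of gate lists have even length. [folklore] -/
theorem two_dvd_length_codeFrom {n : ℕ} : ∀ (j : ℕ) (gs : List (Gate (Fin n))), 2 ∣ (codeFrom j gs).length
  | j, [] => by simp [codeFrom]
  | j, g :: gs => by
    rw [codeFrom, List.length_append]
    exact dvd_add (two_dvd_length_gateCode j g) (two_dvd_length_codeFrom (j + 1) gs)

/-- **The program of a circuit has even length.** [folklore] -/
theorem two_dvd_length_progOf {n : ℕ} (C : Circuit (Fin n)) : 2 ∣ (progOf C).length := by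
  rw [progOf, List.length_append, length_rotCode]
  exact dvd_add (two_dvd_length_codeFrom 0 C.gates) (dvd_mul_right 2 _)

/-- **The padded program of a circuit**: `progOf C` followed by `READ`s up to length `ℓ`. [folklore] -/
def padProg {n : ℕ} (ℓ : ℕ) (C : Circuit (Fin n)) : List Bool :=
  progOf C ++ readPad ((ℓ - (progOf C).length) / 2)

/-- The padded program is clean. [folklore] -/
@[simp] theorem isClean_padProg {n : ℕ} (ℓ : ℕ) (C : Circuit (Fin n)) : isClean (padProg ℓ C) = true := by
  rw [padProg, isClean_append _ _ _ le_rfl (isClean_progOf C), isClean_readPad]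

/-- The padded program has `|C|` table instructions. [folklore] -/
@[simp] theorem tabCount_padProg {n : ℕ} (ℓ : ℕ) (C : Circuit (Fin n)) : tabCount (padProg ℓ C) = C.size := by
  rw [padProg, tabCount_append _ _ _ le_rfl (isClean_progOf C), tabCount_readPad, tabCount_progOf, Nat.add_zero]

/-- Length of the padded program: `ℓ`, for even `ℓ ≥ |progOf C|`. [folklore] -/
theorem length_padProg {n : ℕ} {ℓ : ℕ} (C : Circuit (Fin n)) (hℓ : (progOf C).length ≤ ℓ) (he : 2 ∣ ℓ) :
    (padProg ℓ C).length = ℓ := by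
  rw [padProg, List.length_append, length_readPad]
  obtain ⟨m, hm⟩ := he
  obtain ⟨m', hm'⟩ := two_dvd_length_progOf C
  omega

/-- **The padded program computes the circuit**: on `⟨ofFn x, padProg ℓ C⟩` the evaluator answers
`C x`. [cite: AroraBarak2009, Rem. 6.4] -/
theorem evalFn_padProg {n : ℕ} (ℓ : ℕ) (C : Circuit (Fin n)) (hC : C.IsOver B2) (x : Fin n → Bool) :
    evalFn (boolPair (List.ofFn x) (padProg ℓ C)) = [C.eval x] := by
  have har : ∀ g ∈ C.gates, g.arity ≤ 2 := fun g hg => hC g hg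
  rw [evalFn_boolPair, padProg, progOf, List.append_assoc]
  have h1 := vmSpec_codeFrom x C.gates [] har (fun k hk a m h => by
    have := C.wf k hk a m h; simpa using this)
    (rotCode (depth n C.size C.output) ++ readPad ((ℓ - (codeFrom 0 C.gates ++
      rotCode (depth n C.size C.output)).length) / 2)) []
  rw [List.length_nil] at h1
  have hlen : (valsFrom x [] C.gates).length = C.size := by
    rw [length_valsFrom]; simp [Circuit.size]
  have he : depth n C.size C.output ≤ (layV (valsFrom x [] C.gates) (List.ofFn x)).length := by
    have := depth_le (n := n) C.size C.output
    simp [hlen]; omega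
  rw [h1, vmSpec_rotCode _ _ _ _ _ he]
  obtain ⟨S', hS'⟩ := vmSpec_readPad ((ℓ - (codeFrom 0 C.gates ++ rotCode (depth n C.size C.output)).length) / 2)
    ((layV (valsFrom x [] C.gates) (List.ofFn x)).drop (depth n C.size C.output))
    (((layV (valsFrom x [] C.gates) (List.ofFn x)).take (depth n C.size C.output)).reverse ++ []) []
  have h2 := hS' []
  rw [List.append_nil] at h2
  rw [h2]
  simp only [vmSpec, headD_drop]
  rw [← hlen, getD_layV_depth x _ C.output (fun m hm => hlen ▸ C.wf_output m hm), eval_eq_wval]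

/-! ### 3. The merge predicate and the extension language

Node data is the string `z = ⟨⟨D_L, D_R⟩, ⟨⟨1ʰ, a⟩, 1^σ⟩⟩` (`codeZ`): the programs of the two children,
the free width `h` of the block, its pattern `a` (the high-order bits) and the size bound `σ = s(n)` in
unary. A program `D` is a *valid merge* (`IsValidMerge`) if it has the common length, is clean, has at most
`σ` table instructions, and agrees with `D_L` on the inputs `y ++ 0a` and with `D_R` on the inputs
`y ++ 1a` (`|y| = h`). -/

/-- The node data string `⟨⟨D_L, D_R⟩, ⟨⟨1ʰ, a⟩, 1^σ⟩⟩`. [folklore] -/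
def codeZ (h : ℕ) (a : List Bool) (σ : ℕ) (DL DR : List Bool) : List Bool :=
  boolPair (boolPair DL DR) (boolPair (boolPair (ones h) a) (ones σ))

/-- **Valid merges** (the specification of Circuit-Min-Merge, MMW 2019 §2.1, for two adjacent dyadic
blocks and programs of the evaluation machine). [cite: MckayMurrayWilliams2019, §2.1] -/
structure IsValidMerge (h : ℕ) (a : List Bool) (σ : ℕ) (DL DR D : List Bool) : Prop where
  /-- the common program length -/
  len : D.length = DL.length
  /-- the program is clean -/
  clean : isClean D = true
  /-- at most `σ` table instructions -/
  small : tabCount D ≤ σ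
  /-- agreement with the left child on the left half-block -/
  agreeL : ∀ y : List Bool, y.length = h →
    evalFn (boolPair (y ++ false :: a) D) = evalFn (boolPair (y ++ false :: a) DL)
  /-- agreement with the right child on the right half-block -/
  agreeR : ∀ y : List Bool, y.length = h →
    evalFn (boolPair (y ++ true :: a) D) = evalFn (boolPair (y ++ true :: a) DR)

/-! #### Accessors (on `w = ⟨z, D⟩`) -/

/-- `D_L` of `w = ⟨z, D⟩`. [folklore] -/
def dLeftF : List Bool → List Bool := fstP ∘ fstP ∘ fstP
/-- `D_R` of `w = ⟨z, D⟩`. [folklore] -/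
def dRightF : List Bool → List Bool := sndP ∘ fstP ∘ fstP
/-- `1ʰ` of `w = ⟨z, D⟩`. [folklore] -/
def widthF : List Bool → List Bool := fstP ∘ fstP ∘ sndP ∘ fstP
/-- `a` of `w = ⟨z, D⟩`. [folklore] -/
def patternF : List Bool → List Bool := sndP ∘ fstP ∘ sndP ∘ fstP
/-- `1^σ` of `w = ⟨z, D⟩`. [folklore] -/
def sizeBoundF : List Bool → List Bool := sndP ∘ sndP ∘ fstP
/-- `D` of `w = ⟨z, D⟩`. [folklore] -/
def candF : List Bool → List Bool := sndP

/-- `dLeftF ∈ FP`. [folklore] -/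
theorem dLeftF_mem_FP : dLeftF ∈ FP := comp_mem_FP fstP_mem_FP (comp_mem_FP fstP_mem_FP fstP_mem_FP)
/-- `dRightF ∈ FP`. [folklore] -/
theorem dRightF_mem_FP : dRightF ∈ FP := comp_mem_FP sndP_mem_FP (comp_mem_FP fstP_mem_FP fstP_mem_FP)
/-- `widthF ∈ FP`. [folklore] -/
theorem widthF_mem_FP : widthF ∈ FP :=
  comp_mem_FP fstP_mem_FP (comp_mem_FP fstP_mem_FP (comp_mem_FP sndP_mem_FP fstP_mem_FP))
/-- `patternF ∈ FP`. [folklore] -/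
theorem patternF_mem_FP : patternF ∈ FP :=
  comp_mem_FP sndP_mem_FP (comp_mem_FP fstP_mem_FP (comp_mem_FP sndP_mem_FP fstP_mem_FP))
/-- `sizeBoundF ∈ FP`. [folklore] -/
theorem sizeBoundF_mem_FP : sizeBoundF ∈ FP := comp_mem_FP sndP_mem_FP (comp_mem_FP sndP_mem_FP fstP_mem_FP)
/-- `candF ∈ FP`. [folklore] -/
theorem candF_mem_FP : candF ∈ FP := sndP_mem_FP

section ReadW

variable (h : ℕ) (a : List Bool) (σ : ℕ) (DL DR D : List Bool)

/-- Reading `D_L`. [folklore] -/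
@[simp] theorem dLeftF_apply : dLeftF (boolPair (codeZ h a σ DL DR) D) = DL := by simp [dLeftF, codeZ]
/-- Reading `D_R`. [folklore] -/
@[simp] theorem dRightF_apply : dRightF (boolPair (codeZ h a σ DL DR) D) = DR := by simp [dRightF, codeZ]
/-- Reading `1ʰ`. [folklore] -/
@[simp] theorem widthF_apply : widthF (boolPair (codeZ h a σ DL DR) D) = ones h := by simp [widthF, codeZ]
/-- Reading `a`. [folklore] -/
@[simp] theorem patternF_apply : patternF (boolPair (codeZ h a σ DL DR) D) = a := by simp [patternF, codeZ]
/-- Reading `1^σ`. [folklore] -/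
@[simp] theorem sizeBoundF_apply : sizeBoundF (boolPair (codeZ h a σ DL DR) D) = ones σ := by simp [sizeBoundF, codeZ]
/-- Reading `D`. [folklore] -/
@[simp] theorem candF_apply : candF (boolPair (codeZ h a σ DL DR) D) = D := by simp [candF]

end ReadW

/-- `onesFn y = 1ʰ ↔ |y| = h`. [folklore] -/
theorem onesFn_eq_ones_iff (y : List Bool) (h : ℕ) : onesFn y = ones h ↔ y.length = h := by
  rw [onesFn, OracleCompose.unaryEncodeNat_eq_replicate]
  constructor
  · intro e
    have := congrArg List.length e
    simpa using this
  · intro e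
    rw [e]

/-- `onesFn u = onesFn v ↔ |u| = |v|`. [folklore] -/
theorem onesFn_eq_onesFn_iff (u v : List Bool) : onesFn u = onesFn v ↔ u.length = v.length := by
  rw [show onesFn v = ones v.length from OracleCompose.unaryEncodeNat_eq_replicate _, onesFn_eq_ones_iff]

/-! #### The `P` part of validity: length, cleanliness, size -/

/-- `LENOK`: `|D| = |D_L|`. [folklore] -/
def LENOK : Language Bool := {w | (onesFn ∘ candF) w = (onesFn ∘ dLeftF) w}

/-- `CLN`: `D` is clean. [folklore] -/
def CLN : Language Bool := {w | (cleanT.eval ∘ candF) w = (fun _ => [true]) w}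

/-- `SML`: `#TAB D ≤ σ` (`|1^{#TAB D}| ≤ |1^σ|`). [folklore] -/
def SML : Language Bool := fanoutFn sizeBoundF (tabMarksT.eval ∘ candF) ⁻¹' LenLe Polynomial.X

/-- `V123 = LENOK ⊓ CLN ⊓ SML`. [folklore] -/
def V123 : Language Bool := LENOK ⊓ CLN ⊓ SML

/-- `V123 ∈ P`. [folklore] -/
theorem V123_mem_P : V123 ∈ P :=
  inter_mem_P (inter_mem_P
    (setOf_apply_eq_apply_mem_P (comp_mem_FP onesFn_mem_FP candF_mem_FP) (comp_mem_FP onesFn_mem_FP dLeftF_mem_FP))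
    (setOf_apply_eq_apply_mem_P (comp_mem_FP cleanT_mem_FP candF_mem_FP) (const_mem_FP _)))
    (preimage_mem_P (LenLe_mem_P _) (fanoutFn_mem_FP sizeBoundF_mem_FP (comp_mem_FP tabMarksT_mem_FP candF_mem_FP)))

/-- Reading `V123`. [folklore] -/
theorem mem_V123_iff (h : ℕ) (a : List Bool) (σ : ℕ) (DL DR D : List Bool) :
    boolPair (codeZ h a σ DL DR) D ∈ V123 ↔ D.length = DL.length ∧ isClean D = true ∧ tabCount D ≤ σ := by
  rw [V123, memL_inf, memL_inf, LENOK, CLN, SML, memL_setOf, memL_setOf, memL_preimage]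
  simp only [Function.comp_apply, candF_apply, dLeftF_apply, sizeBoundF_apply, fanoutFn_apply, onesFn_eq_onesFn_iff,
    cleanT_eval, tabMarksT_eval, boolPair_mem_LenLe, Polynomial.eval_X, List.cons.injEq, and_true]
  simp [ones, and_assoc]

/-! #### The matrix of the agreement test (on `v = ⟨w, y⟩`) -/

/-- The left test point `y ++ 0a` of a row `v = ⟨w, y⟩`. [folklore] -/
def ptL (v : List Bool) : List Bool := sndP v ++ false :: (patternF ∘ fstP) v

/-- The right test point `y ++ 1a` of a row `v = ⟨w, y⟩`. [folklore] -/
def ptR (v : List Bool) : List Bool := sndP v ++ true :: (patternF ∘ fstP) v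

/-- `ptL ∈ FP`. [folklore] -/
theorem ptL_mem_FP : ptL ∈ FP :=
  append_mem_FP sndP_mem_FP (comp_mem_FP (cons_mem_FP false) (comp_mem_FP patternF_mem_FP fstP_mem_FP))

/-- `ptR ∈ FP`. [folklore] -/
theorem ptR_mem_FP : ptR ∈ FP :=
  append_mem_FP sndP_mem_FP (comp_mem_FP (cons_mem_FP true) (comp_mem_FP patternF_mem_FP fstP_mem_FP))

/-- The evaluator's answer of `D` at the left test point. [folklore] -/
def lhsL : List Bool → List Bool := evalFn ∘ fanoutFn ptL (candF ∘ fstP)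
/-- The evaluator's answer of `D_L` at the left test point. [folklore] -/
def rhsL : List Bool → List Bool := evalFn ∘ fanoutFn ptL (dLeftF ∘ fstP)
/-- The evaluator's answer of `D` at the right test point. [folklore] -/
def lhsR : List Bool → List Bool := evalFn ∘ fanoutFn ptR (candF ∘ fstP)
/-- The evaluator's answer of `D_R` at the right test point. [folklore] -/
def rhsR : List Bool → List Bool := evalFn ∘ fanoutFn ptR (dRightF ∘ fstP)

/-- `lhsL ∈ FP`. [folklore] -/
theorem lhsL_mem_FP : lhsL ∈ FP :=
  comp_mem_FP evalFn_mem_FP (fanoutFn_mem_FP ptL_mem_FP (comp_mem_FP candF_mem_FP fstP_mem_FP))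
/-- `rhsL ∈ FP`. [folklore] -/
theorem rhsL_mem_FP : rhsL ∈ FP :=
  comp_mem_FP evalFn_mem_FP (fanoutFn_mem_FP ptL_mem_FP (comp_mem_FP dLeftF_mem_FP fstP_mem_FP))
/-- `lhsR ∈ FP`. [folklore] -/
theorem lhsR_mem_FP : lhsR ∈ FP :=
  comp_mem_FP evalFn_mem_FP (fanoutFn_mem_FP ptR_mem_FP (comp_mem_FP candF_mem_FP fstP_mem_FP))
/-- `rhsR ∈ FP`. [folklore] -/
theorem rhsR_mem_FP : rhsR ∈ FP :=
  comp_mem_FP evalFn_mem_FP (fanoutFn_mem_FP ptR_mem_FP (comp_mem_FP dRightF_mem_FP fstP_mem_FP))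

/-- `EQL`: `D` agrees with `D_L` at the left test point of the row. [folklore] -/
def EQL : Language Bool := {v | lhsL v = rhsL v}

/-- `EQR`: `D` agrees with `D_R` at the right test point of the row. [folklore] -/
def EQR : Language Bool := {v | lhsR v = rhsR v}

/-- `YLEN`: the row's `y` has length `h`. [folklore] -/
def YLEN : Language Bool := {v | (onesFn ∘ sndP) v = (widthF ∘ fstP) v}

/-- **The matrix language**: `⟨w, y⟩ ∈ MAT` iff `w ∈ V123` and (`|y| ≠ h` or `D` agrees with both
children at the two test points of `y`). [cite: MckayMurrayWilliams2019, §2.1] -/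
def MAT : Language Bool := (fstP ⁻¹' V123) ⊓ (YLENᶜ ⊔ (EQL ⊓ EQR))

/-- **`MAT ∈ P`** ("Circuit-Min-Merge is computable in the polynomial-time hierarchy": its matrix is
polynomial time). [cite: MckayMurrayWilliams2019, §2.1] -/
theorem MAT_mem_P : MAT ∈ P :=
  inter_mem_P (preimage_mem_P V123_mem_P fstP_mem_FP)
    (union_mem_P ((compl_mem_P_iff (L := YLEN)).2
      (setOf_apply_eq_apply_mem_P (comp_mem_FP onesFn_mem_FP sndP_mem_FP) (comp_mem_FP widthF_mem_FP fstP_mem_FP)))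
      (inter_mem_P (setOf_apply_eq_apply_mem_P lhsL_mem_FP rhsL_mem_FP)
        (setOf_apply_eq_apply_mem_P lhsR_mem_FP rhsR_mem_FP)))

/-- Reading `MAT`. [folklore] -/
theorem mem_MAT_iff (h : ℕ) (a : List Bool) (σ : ℕ) (DL DR D y : List Bool) :
    boolPair (boolPair (codeZ h a σ DL DR) D) y ∈ MAT ↔
      (D.length = DL.length ∧ isClean D = true ∧ tabCount D ≤ σ) ∧
      (y.length = h →
        evalFn (boolPair (y ++ false :: a) D) = evalFn (boolPair (y ++ false :: a) DL) ∧
        evalFn (boolPair (y ++ true :: a) D) = evalFn (boolPair (y ++ true :: a) DR)) := by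
  rw [MAT, memL_inf, memL_preimage, fstP_boolPair, mem_V123_iff, memL_sup, memL_inf]
  rw [show (boolPair (boolPair (codeZ h a σ DL DR) D) y ∈ YLENᶜ) ↔
      ¬ boolPair (boolPair (codeZ h a σ DL DR) D) y ∈ YLEN from Iff.rfl]
  rw [YLEN, EQL, EQR, memL_setOf, memL_setOf, memL_setOf]
  simp only [lhsL, rhsL, lhsR, rhsR, ptL, ptR, Function.comp_apply, fanoutFn_apply, fstP_boolPair,
    sndP_boolPair, candF_apply, dLeftF_apply, dRightF_apply, patternF_apply, widthF_apply, onesFn_eq_ones_iff]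
  rw [← imp_iff_not_or]

/-! #### Validity and the extension language -/

/-- **`VALID`**: `⟨z, D⟩ ∈ VALID` iff `D` is a valid merge for the node data `z` — a polynomially
bounded `∀`-projection of `MAT`. [cite: MckayMurrayWilliams2019, §2.1] -/
def VALID : Language Bool :=
  {w | ∀ y : List Bool, y.length ≤ (Polynomial.X : Polynomial ℕ).eval w.length → boolPair w y ∈ MAT}

/-- **Under `NP ⊆ P/poly`, `VALID ∈ P/poly`** (`coNP ⊆ P/poly`). [cite: MckayMurrayWilliams2019, §5] -/
theorem VALID_mem_PPoly (hNP : NP ⊆ PPoly) : VALID ∈ PPoly :=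
  forall_mem_PPoly hNP (P_subset_PPoly_holds MAT_mem_P) Polynomial.X

/-- Reading `VALID`. [cite: MckayMurrayWilliams2019, §2.1] -/
theorem mem_VALID_iff (h : ℕ) (a : List Bool) (σ : ℕ) (DL DR D : List Bool) :
    boolPair (codeZ h a σ DL DR) D ∈ VALID ↔ IsValidMerge h a σ DL DR D := by
  have hbound : ∀ y : List Bool, y.length = h →
      y.length ≤ (Polynomial.X : Polynomial ℕ).eval (boolPair (codeZ h a σ DL DR) D).length := by
    intro y hy
    simp only [Polynomial.eval_X, codeZ, length_boolPair, List.length_replicate]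
    omega
  rw [VALID, memL_setOf]
  constructor
  · intro hv
    have h0 := hv [] (Nat.zero_le _)
    rw [mem_MAT_iff] at h0
    obtain ⟨⟨hlen, hcl, hsm⟩, -⟩ := h0
    refine ⟨hlen, hcl, hsm, fun y hy => ?_, fun y hy => ?_⟩
    · exact (((mem_MAT_iff h a σ DL DR D y).1 (hv y (hbound y hy))).2 hy).1
    · exact (((mem_MAT_iff h a σ DL DR D y).1 (hv y (hbound y hy))).2 hy).2
  · intro hV y _
    rw [mem_MAT_iff]
    exact ⟨⟨hV.len, hV.clean, hV.small⟩, fun hy => ⟨hV.agreeL y hy, hV.agreeR y hy⟩⟩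

/-- The glue `⟨⟨z, π⟩, τ⟩ ↦ ⟨z, π ++ τ⟩`. [folklore] -/
def glueF : List Bool → List Bool :=
  fanoutFn (fstP ∘ fstP) (fun u => (sndP ∘ fstP) u ++ sndP u)

/-- `glueF ∈ FP`. [folklore] -/
theorem glueF_mem_FP : glueF ∈ FP :=
  fanoutFn_mem_FP (comp_mem_FP fstP_mem_FP fstP_mem_FP)
    (append_mem_FP (comp_mem_FP sndP_mem_FP fstP_mem_FP) sndP_mem_FP)

/-- Reading the glue. [folklore] -/
@[simp] theorem glueF_apply (z π τ : List Bool) : glueF (boolPair (boolPair z π) τ) = boolPair z (π ++ τ) := by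
  simp [glueF]

/-- The glued validity language `{⟨⟨z, π⟩, τ⟩ | ⟨z, π ++ τ⟩ ∈ VALID}`. [folklore] -/
def GEXT : Language Bool := glueF ⁻¹' VALID

/-- **The extension language** `EXT = {⟨z, π⟩ | some valid merge for z extends the prefix π}`
(the self-reduction language of the search problem "find a valid merge"). [cite: AroraBarak2009, Thm. 2.18] -/
def EXT : Language Bool :=
  {u | ∃ τ : List Bool, τ.length ≤ (Polynomial.X : Polynomial ℕ).eval u.length ∧ boolPair u τ ∈ GEXT}

/-- **Under `NP ⊆ P/poly`, `EXT ∈ P/poly`** (`∃ᵖ·coNP ⊆ PH ⊆ P/poly`; MMW 2019, §5: "the entire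
polynomial hierarchy collapses to `C`, including the Circuit-Min-Merge problem"). [cite: MckayMurrayWilliams2019, §5] -/
theorem EXT_mem_PPoly (hNP : NP ⊆ PPoly) : EXT ∈ PPoly :=
  exists_mem_PPoly hNP (M := GEXT) (preimage_mem_PPoly (VALID_mem_PPoly hNP) glueF_mem_FP) Polynomial.X

/-- Reading `EXT`. [cite: AroraBarak2009, Thm. 2.18] -/
theorem mem_EXT_iff (h : ℕ) (a : List Bool) (σ : ℕ) (DL DR π : List Bool) :
    boolPair (codeZ h a σ DL DR) π ∈ EXT ↔ ∃ τ : List Bool, IsValidMerge h a σ DL DR (π ++ τ) := by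
  rw [EXT, memL_setOf]
  constructor
  · rintro ⟨τ, -, hτ⟩
    rw [GEXT, memL_preimage, glueF_apply, mem_VALID_iff] at hτ
    exact ⟨τ, hτ⟩
  · rintro ⟨τ, hV⟩
    refine ⟨τ, ?_, ?_⟩
    · have h1 := hV.len
      rw [List.length_append] at h1
      simp only [Polynomial.eval_X, codeZ, length_boolPair]
      omega
    · rwa [GEXT, memL_preimage, glueF_apply, mem_VALID_iff]

/-! ### 4. The canonical merge: bit-by-bit self-reduction

`greedy z k` is the length-`k` prefix of the lexicographically first valid merge (when one exists):
extend by `0` if some valid merge extends the prefix so continued, else by `1` (Arora–Barak 2009,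
Thm. 2.18; MMW 2019, §2.1: "the (unique) circuit `C'` in the output specification … every circuit `C''`
that comes before `C'` (with respect to the natural ordering) fails the specification"). -/

/-- The greedy prefix of length `k`. [cite: AroraBarak2009, Thm. 2.18] -/
def greedy (z : List Bool) : ℕ → List Bool
  | 0 => []
  | k + 1 => greedy z k ++ [decide (boolPair z (greedy z k ++ [false]) ∉ EXT)]

/-- The recursion of `greedy` (definitional). [folklore] -/
theorem greedy_succ (z : List Bool) (k : ℕ) :
    greedy z (k + 1) = greedy z k ++ [decide (boolPair z (greedy z k ++ [false]) ∉ EXT)] := rfl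

/-- The greedy prefix of length `k` has length `k`. [folklore] -/
@[simp] theorem length_greedy (z : List Bool) : ∀ k : ℕ, (greedy z k).length = k
  | 0 => rfl
  | k + 1 => by rw [greedy_succ, List.length_append, length_greedy z k]; rfl

/-- Earlier bits of the greedy prefix are stable. [folklore] -/
theorem getD_greedy_succ (z : List Bool) (k j : ℕ) (hj : j < k) :
    (greedy z (k + 1)).getD j false = (greedy z k).getD j false := by
  rw [greedy_succ, List.getD_eq_getElem?_getD, List.getElem?_append_left (by simpa using hj),
    ← List.getD_eq_getElem?_getD]

/-- The new bit of the greedy prefix. [folklore] -/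
theorem getD_greedy_succ_self (z : List Bool) (k : ℕ) :
    (greedy z (k + 1)).getD k false = decide (boolPair z (greedy z k ++ [false]) ∉ EXT) := by
  rw [greedy_succ, List.getD_eq_getElem?_getD, List.getElem?_append_right (by simp)]
  simp

/-- **Invariant of the self-reduction**: if some valid merge exists, every greedy prefix up to the
program length extends to a valid merge. [cite: AroraBarak2009, Thm. 2.18] -/
theorem greedy_mem_EXT (h : ℕ) (a : List Bool) (σ : ℕ) (DL DR : List Bool)
    (h0 : boolPair (codeZ h a σ DL DR) [] ∈ EXT) :
    ∀ k : ℕ, k ≤ DL.length → boolPair (codeZ h a σ DL DR) (greedy (codeZ h a σ DL DR) k) ∈ EXT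
  | 0, _ => h0
  | k + 1, hk => by
    set z := codeZ h a σ DL DR with hz
    have ih := greedy_mem_EXT h a σ DL DR h0 k (Nat.le_of_succ_le hk)
    rw [← hz] at ih
    obtain ⟨τ, hV⟩ := (mem_EXT_iff h a σ DL DR _).1 ih
    have hτ : τ ≠ [] := by
      intro he
      have := hV.len
      rw [he, List.append_nil, length_greedy] at this
      omega
    obtain ⟨b, τ', rfl⟩ := List.exists_cons_of_ne_nil hτ
    rw [greedy_succ]
    by_cases hc : boolPair z (greedy z k ++ [false]) ∈ EXT
    · have hd : decide (boolPair z (greedy z k ++ [false]) ∉ EXT) = false := by simp [hc]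
      rwa [hd]
    · have hd : decide (boolPair z (greedy z k ++ [false]) ∉ EXT) = true := by simp [hc]
      rw [hd]
      cases b
      · exact absurd ((mem_EXT_iff h a σ DL DR _).2 ⟨τ', by simpa using hV⟩) hc
      · exact (mem_EXT_iff h a σ DL DR _).2 ⟨τ', by simpa using hV⟩

/-- **Correctness of the self-reduction**: if some valid merge exists, the greedy string of the full
program length is a valid merge. [cite: AroraBarak2009, Thm. 2.18] -/
theorem isValidMerge_greedy (h : ℕ) (a : List Bool) (σ : ℕ) (DL DR : List Bool)
    (h0 : boolPair (codeZ h a σ DL DR) [] ∈ EXT) :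
    IsValidMerge h a σ DL DR (greedy (codeZ h a σ DL DR) DL.length) := by
  obtain ⟨τ, hV⟩ := (mem_EXT_iff h a σ DL DR _).1 (greedy_mem_EXT h a σ DL DR h0 DL.length le_rfl)
  have hτ : τ = [] := by
    have := hV.len
    rw [List.length_append, length_greedy] at this
    exact List.eq_nil_of_length_eq_zero (by omega)
  rw [hτ, List.append_nil] at hV
  exact hV

/-- Conversely, a valid merge of the greedy string witnesses `⟨z, []⟩ ∈ EXT`. [folklore] -/
theorem nil_mem_EXT_of_isValidMerge {h : ℕ} {a : List Bool} {σ : ℕ} {DL DR D : List Bool}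
    (hV : IsValidMerge h a σ DL DR D) : boolPair (codeZ h a σ DL DR) [] ∈ EXT :=
  (mem_EXT_iff h a σ DL DR []).2 ⟨D, by simpa using hV⟩


/-! ### 5. Circuits: look-ups, the self-reduction chain, the merge node and the leaves -/

/-- The `P/poly` look-up of `EXT` on the pair of the two input blocks. [folklore] -/
def lookupFn (n m : ℕ) (w : Fin n ⊕ Fin m → Bool) (_ : Unit) : Bool :=
  EXT.boolIndicator (boolPair (List.ofFn fun i => w (.inl i)) (List.ofFn fun j => w (.inr j)))

/-- The size of the look-up circuits on blocks of lengths `n`, `m`, for a size polynomial `q`. [folklore] -/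
def LB (q : Polynomial ℕ) (n m : ℕ) : ℕ := (2 * n + 2 + m) + q.eval (2 * n + 2 + m)

/-- `LB` is monotone in both block lengths. [folklore] -/
theorem LB_mono (q : Polynomial ℕ) {n n' m m' : ℕ} (hn : n ≤ n') (hm : m ≤ m') : LB q n m ≤ LB q n' m' := by
  have := TM2Iter.eval_mono q (show 2 * n + 2 + m ≤ 2 * n' + 2 + m' by omega)
  simp only [LB]
  omega

/-- **Under `NP ⊆ P/poly` the look-ups have polynomial-size circuits.** [cite: MckayMurrayWilliams2019, §5] -/
theorem exists_lookup (hNP : NP ⊆ PPoly) : ∃ q : Polynomial ℕ, ∀ n m : ℕ, CktSize B2 (lookupFn n m) (LB q n m) :=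
  exists_cktSize_boolPair_of_mem_PPoly (EXT_mem_PPoly hNP)

/-- `¬[w ∈ L] = [w ∉ L]`. [folklore] -/
theorem not_boolIndicator_eq (L : Language Bool) (w : List Bool) : (!L.boolIndicator w) = decide (w ∉ L) := by
  by_cases hw : w ∈ L
  · rw [(Set.mem_iff_boolIndicator _ _).1 hw]; simp [hw]
  · rw [(Set.notMem_iff_boolIndicator _ _).1 hw]; simp [hw]

/-- A list of known length is the `ofFn` of its `getD`. [folklore] -/
theorem ofFn_getD_eq {l : List Bool} {k : ℕ} (hl : l.length = k) :
    (List.ofFn fun j : Fin k => l.getD j false) = l := by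
  subst hl
  apply List.ext_getElem (by simp)
  intro i h1 h2
  rw [List.getElem_ofFn, List.getD_eq_getElem _ _ h2]

section Chain

variable {q : Polynomial ℕ} (hq : ∀ n m : ℕ, CktSize B2 (lookupFn n m) (LB q n m))
include hq

/-- The state of the self-reduction after `k` rounds: the node data `x` and the greedy prefix. [folklore] -/
def stFn (m₀ k : ℕ) (x : Fin m₀ → Bool) : Fin m₀ ⊕ Fin k → Bool :=
  Sum.elim x fun j => (greedy (List.ofFn x) k).getD j false

omit hq in
/-- The state reads the data on the left. [folklore] -/
@[simp] theorem stFn_inl (m₀ k : ℕ) (x : Fin m₀ → Bool) (i : Fin m₀) : stFn m₀ k x (.inl i) = x i := rfl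

omit hq in
/-- The state reads the greedy prefix on the right. [folklore] -/
@[simp] theorem stFn_inr (m₀ k : ℕ) (x : Fin m₀ → Bool) (j : Fin k) :
    stFn m₀ k x (.inr j) = (greedy (List.ofFn x) k).getD j false := rfl

/-- The next bit of the self-reduction, read off a state: `1` iff the prefix continued by `0` does
not extend to a valid merge. [cite: AroraBarak2009, Thm. 2.18] -/
def newBit (m₀ k : ℕ) (w : Fin m₀ ⊕ Fin k → Bool) : Bool :=
  !EXT.boolIndicator (boolPair (List.ofFn fun i => w (.inl i)) ((List.ofFn fun j => w (.inr j)) ++ [false]))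

/-- Re-indexing: the extended state `(x, π, b)` as a state with a prefix of length `k + 1`. [folklore] -/
def extIdx (m₀ k : ℕ) : Fin m₀ ⊕ Fin (k + 1) → (Fin m₀ ⊕ Fin k) ⊕ Unit
  | .inl i => .inl (.inl i)
  | .inr j => Fin.lastCases (.inr ()) (fun j' => .inl (.inr j')) j

/-- **One round of the self-reduction costs one look-up and two gates.** [cite: AroraBarak2009, Thm. 2.18] -/
theorem cktSize_newBit (m₀ k : ℕ) : CktSize B2 (fun w (_ : Unit) => newBit m₀ k w) (LB q m₀ (k + 1) + 2) := by
  have h1 : CktSize B2 (fun (w : Fin m₀ ⊕ Fin k → Bool) => Sum.elim w (fun _ : Unit => false)) (0 + 1) :=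
    (CktSize.id B2).pair (cktSize_const _ false)
  have h2 := h1.outMap (extIdx m₀ k)
  have h3 := h2.comp (hq m₀ (k + 1))
  have h4 := h3.comp (cktSize_not (ι := Unit) ())
  refine (h4.of_le (by omega)).congr fun w _ => ?_
  simp only [lookupFn, newBit, extIdx, Sum.elim_inl]
  congr 3
  rw [List.ofFn_succ', List.concat_eq_append]
  simp

/-- **`k` rounds of the self-reduction cost `k` look-ups** (plus two gates each). [cite: AroraBarak2009, Thm. 2.18] -/
theorem cktSize_stFn (m₀ K : ℕ) : ∀ k : ℕ, k ≤ K → CktSize B2 (stFn m₀ k) (k * (LB q m₀ (K + 1) + 2))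
  | 0, _ => by
    have h : CktSize B2 (fun (x : Fin m₀ → Bool) =>
        Sum.elim x (fun j : Fin 0 => (greedy (List.ofFn x) 0).getD j false)) (0 + 0) :=
      (CktSize.id B2).pair (CktSize.of_isEmpty B2 _)
    exact (h.of_le (by simp)).congr fun x t => by rcases t with i | j <;> rfl
  | k + 1, hk => by
    have ih := cktSize_stFn m₀ K k (Nat.le_of_succ_le hk)
    have h1 := ih.comp ((CktSize.id B2).pair (cktSize_newBit hq m₀ k))
    have h2 := h1.outMap (extIdx m₀ k)
    refine (h2.of_le ?_).congr fun x t => ?_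
    · have := LB_mono q (le_refl m₀) (show k + 1 ≤ K + 1 by omega)
      rw [Nat.succ_mul]
      omega
    · rcases t with i | j
      · rfl
      · refine Fin.lastCases ?_ (fun j' => ?_) j
        · simp only [extIdx, Fin.lastCases_last, Sum.elim_inr, stFn_inr, Fin.val_last]
          rw [getD_greedy_succ_self, newBit, not_boolIndicator_eq, decide_eq_decide]
          simp only [stFn_inl, stFn_inr]
          rw [ofFn_getD_eq (length_greedy (List.ofFn x) k)]
        · simp only [extIdx, Fin.lastCases_castSucc, Sum.elim_inl, stFn_inr, Fin.val_castSucc]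
          rw [getD_greedy_succ _ _ _ j'.2]

end Chain

/-! #### Node data as a bit vector -/

/-- Length of the constant part `⟨⟨1ʰ, a⟩, 1^σ⟩` of the node data. [folklore] -/
abbrev cLen (h : ℕ) (a : List Bool) (σ : ℕ) : ℕ := 2 * (2 * h + 2 + a.length) + 2 + σ

/-- The constant part `⟨⟨1ʰ, a⟩, 1^σ⟩` of the node data, as a bit vector. [folklore] -/
def cVec (h : ℕ) (a : List Bool) (σ : ℕ) : Fin (cLen h a σ) → Bool :=
  pairVec (pairVec (fun _ : Fin h => true) fun i : Fin a.length => a.get i) fun _ : Fin σ => true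

/-- The constant part lists as `⟨⟨1ʰ, a⟩, 1^σ⟩`. [folklore] -/
theorem ofFn_cVec (h : ℕ) (a : List Bool) (σ : ℕ) :
    List.ofFn (cVec h a σ) = boolPair (boolPair (ones h) a) (ones σ) := by
  unfold cVec
  rw [ofFn_pairVec, ofFn_pairVec, List.ofFn_const, List.ofFn_const, List.ofFn_get]

/-- Length of the node data `z = ⟨⟨D_L, D_R⟩, ⟨⟨1ʰ, a⟩, 1^σ⟩⟩` for programs of length `ℓ`. [folklore] -/
abbrev zLen (ℓ h : ℕ) (a : List Bool) (σ : ℕ) : ℕ := 2 * (2 * ℓ + 2 + ℓ) + 2 + cLen h a σ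

/-- The node data as a bit vector. [folklore] -/
def zVec (ℓ h : ℕ) (a : List Bool) (σ : ℕ) (DL DR : Fin ℓ → Bool) : Fin (zLen ℓ h a σ) → Bool :=
  pairVec (pairVec DL DR) (cVec h a σ)

/-- The node data vector lists as `codeZ`. [folklore] -/
theorem ofFn_zVec (ℓ h : ℕ) (a : List Bool) (σ : ℕ) (DL DR : Fin ℓ → Bool) :
    List.ofFn (zVec ℓ h a σ DL DR) = codeZ h a σ (List.ofFn DL) (List.ofFn DR) := by
  unfold zVec
  rw [ofFn_pairVec, ofFn_pairVec, ofFn_cVec, codeZ]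

/-- **Wiring the node data** from the two child programs costs at most `2 · |z|` (constant) gates.
[cite: Vollmer1999, §1.1] -/
theorem cktSize_zVec (ℓ h : ℕ) (a : List Bool) (σ : ℕ) :
    CktSize B2 (fun (w : Fin ℓ ⊕ Fin ℓ → Bool) => zVec ℓ h a σ (fun i => w (.inl i)) (fun i => w (.inr i)))
      (2 * zLen ℓ h a σ) := by
  have h1 := cktSize_pairVec ℓ ℓ
  have h2 : CktSize B2 (fun (_ : Fin ℓ ⊕ Fin ℓ → Bool) (t : Fin (cLen h a σ)) => cVec h a σ t)
      (Fintype.card (Fin (cLen h a σ)) * 1) :=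
    CktSize.pi_const fun t => cktSize_const _ _
  have h3 := (h1.pair h2).comp (cktSize_pairVec (2 * ℓ + 2 + ℓ) (cLen h a σ))
  refine (h3.of_le ?_).congr fun w t => ?_
  · simp only [Fintype.card_fin, zLen]
    omega
  · simp only [zVec, Sum.elim_inl, Sum.elim_inr]

/-! #### The merge node -/

/-- **The merge node** (one Circuit-Min-Merge gate of Lemma 3.1 with its `P/poly` circuit plugged
in): from the two children's `(flag, program)` compute the flag "both children succeeded and a
valid merge exists" and the canonical valid merge. [cite: MckayMurrayWilliams2019, Lemma 3.1] -/
def mergeOut (ℓ h : ℕ) (a : List Bool) (σ : ℕ) (L R : Unit ⊕ Fin ℓ → Bool) : Unit ⊕ Fin ℓ → Bool :=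
  Sum.elim
    (fun _ => L (.inl ()) && R (.inl ()) &&
      EXT.boolIndicator (boolPair (codeZ h a σ (List.ofFn fun i => L (.inr i)) (List.ofFn fun i => R (.inr i))) []))
    (fun j => (greedy (codeZ h a σ (List.ofFn fun i => L (.inr i)) (List.ofFn fun i => R (.inr i))) ℓ).getD j false)

/-- The size of a merge node with data of length `m₀`. [folklore] -/
def mergeSize (q : Polynomial ℕ) (ℓ m₀ : ℕ) : ℕ := 2 * m₀ + (LB q m₀ 0 + 2 + ℓ * (LB q m₀ (ℓ + 1) + 2))

/-- `mergeSize` is monotone in the data length. [folklore] -/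
theorem mergeSize_mono (q : Polynomial ℕ) (ℓ : ℕ) {m₀ m₀' : ℕ} (h : m₀ ≤ m₀') :
    mergeSize q ℓ m₀ ≤ mergeSize q ℓ m₀' := by
  have h1 := LB_mono q h (le_refl 0)
  have h2 := LB_mono q h (le_refl (ℓ + 1))
  simp only [mergeSize]
  have := Nat.mul_le_mul_left ℓ (Nat.add_le_add_right h2 2)
  omega

section Merge

variable {q : Polynomial ℕ} (hq : ∀ n m : ℕ, CktSize B2 (lookupFn n m) (LB q n m))
include hq

/-- Stage two of the merge node on `(f_L, f_R, z)`: the flag and the greedy program. [folklore] -/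
theorem cktSize_merge_stage2 (ℓ m₀ : ℕ) :
    CktSize B2 (fun (v : (Unit ⊕ Unit) ⊕ Fin m₀ → Bool) =>
      Sum.elim (fun (_ : Unit) => v (.inl (.inl ())) && v (.inl (.inr ())) &&
          lookupFn m₀ 0 (Sum.elim (fun i => v (.inr i)) Fin.elim0) ())
        (fun j : Fin ℓ => stFn m₀ ℓ (fun i => v (.inr i)) (.inr j)))
      (LB q m₀ 0 + 2 + ℓ * (LB q m₀ (ℓ + 1) + 2)) := by
  -- the flag
  have hF : CktSize B2 (fun (v : (Unit ⊕ Unit) ⊕ Fin m₀ → Bool) (_ : Unit) =>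
      lookupFn m₀ 0 (Sum.elim (fun i => v (.inr i)) Fin.elim0) ()) (LB q m₀ 0) :=
    ((hq m₀ 0).rewire (ι' := (Unit ⊕ Unit) ⊕ Fin m₀) (Sum.elim (fun i => .inr i) Fin.elim0)).congr
      fun v _ => by
        congr 1
        funext t
        rcases t with i | j
        · rfl
        · exact j.elim0
  have hF1 : CktSize B2 (fun (v : (Unit ⊕ Unit) ⊕ Fin m₀ → Bool) =>
      Sum.elim v (fun (_ : Unit) => lookupFn m₀ 0 (Sum.elim (fun i => v (.inr i)) Fin.elim0) ())) (0 + LB q m₀ 0) :=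
    (CktSize.id B2).pair hF
  have hF2 := hF1.comp ((CktSize.id B2).pair
    (cktSize_and (ι := ((Unit ⊕ Unit) ⊕ Fin m₀) ⊕ Unit) (.inl (.inl (.inl ()))) (.inl (.inl (.inr ())))))
  have hF3 := hF2.comp (cktSize_and (ι := (((Unit ⊕ Unit) ⊕ Fin m₀) ⊕ Unit) ⊕ Unit) (.inr ()) (.inl (.inr ())))
  -- the program
  have hP := ((cktSize_stFn hq m₀ ℓ ℓ le_rfl).rewire (ι' := (Unit ⊕ Unit) ⊕ Fin m₀) (fun i => .inr i)).outMap
    (fun j : Fin ℓ => (Sum.inr j : Fin m₀ ⊕ Fin ℓ))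
  refine ((hF3.pair hP).of_le (by omega)).congr fun v t => ?_
  rcases t with u | j
  · simp
  · simp

/-- **The merge node has `mergeSize` gates** — `ℓ + 1` look-ups and wiring (`poly(s)` under
`NP ⊆ P/poly`). [cite: MckayMurrayWilliams2019, Lemma 3.1 and §5] -/
theorem cktSize_mergeOut (ℓ h : ℕ) (a : List Bool) (σ : ℕ) :
    CktSize B2 (fun (w : (Unit ⊕ Fin ℓ) ⊕ (Unit ⊕ Fin ℓ) → Bool) =>
      mergeOut ℓ h a σ (fun t => w (.inl t)) (fun t => w (.inr t))) (mergeSize q ℓ (zLen ℓ h a σ)) := by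
  set m₀ := zLen ℓ h a σ with hm₀
  -- stage one: flags through, node data wired
  have hZ := (cktSize_zVec ℓ h a σ).rewire (ι' := (Unit ⊕ Fin ℓ) ⊕ (Unit ⊕ Fin ℓ))
    (Sum.elim (fun i => .inl (.inr i)) (fun i => .inr (.inr i)))
  have h1 : CktSize B2 (fun (w : (Unit ⊕ Fin ℓ) ⊕ (Unit ⊕ Fin ℓ) → Bool) =>
      Sum.elim (Sum.elim (fun (_ : Unit) => w (.inl (.inl ()))) (fun (_ : Unit) => w (.inr (.inl ()))))
        (zVec ℓ h a σ (fun i => w (.inl (.inr i))) (fun i => w (.inr (.inr i))))) (0 + 2 * m₀) :=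
    ((CktSize.proj B2 (Sum.elim (fun (_ : Unit) => Sum.inl (Sum.inl ()))
        (fun (_ : Unit) => Sum.inr (Sum.inl ())))).congr
      (fun w t => by rcases t with u | u <;> rfl)).pair (hZ.congr fun w t => by simp)
  have h2 := h1.comp (cktSize_merge_stage2 hq ℓ m₀)
  refine (h2.of_le (by simp [mergeSize])).congr fun w t => ?_
  have hz : (List.ofFn fun i : Fin m₀ => zVec ℓ h a σ (fun i => w (.inl (.inr i))) (fun i => w (.inr (.inr i))) i) =
      codeZ h a σ (List.ofFn fun i => w (.inl (.inr i))) (List.ofFn fun i => w (.inr (.inr i))) := ofFn_zVec ..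
  rcases t with u | j
  · simp only [Sum.elim_inl, Sum.elim_inr, lookupFn, mergeOut, List.ofFn_zero, hz]
  · simp only [Sum.elim_inr, stFn_inr, mergeOut, hz]

end Merge

/-! #### The leaves -/

/-- **A leaf**: flag `1` and the leaf program of the bit read ("At the bottom layer …").
[cite: MckayMurrayWilliams2019, Lemma 3.1] -/
def leafOut (ℓ : ℕ) (T : Fin 1 → Bool) : Unit ⊕ Fin ℓ → Bool :=
  Sum.elim (fun _ => true) fun j => (leafProg ℓ (T 0)).getD j false

/-- A Boolean function of one input bit costs at most one gate over `B₂`. [cite: Vollmer1999, §1.1] -/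
theorem cktSize_apply_bool {ι : Type} (g : Bool → Bool) (i : ι) :
    CktSize B2 (fun (x : ι → Bool) (_ : Unit) => g (x i)) 1 := by
  cases hf : g false <;> cases ht : g true
  · exact (cktSize_const ι false).congr fun x _ => by cases x i <;> simp [hf, ht]
  · exact ((CktSize.proj B2 fun _ : Unit => i).of_le zero_le_one).congr fun x _ => by
      cases x i <;> simp [hf, ht]
  · exact (cktSize_not i).congr fun x _ => by cases x i <;> simp [hf, ht]
  · exact (cktSize_const ι true).congr fun x _ => by cases x i <;> simp [hf, ht]

/-- **A leaf costs `ℓ + 1` gates.** [cite: MckayMurrayWilliams2019, Lemma 3.1] -/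
theorem cktSize_leafOut (ℓ : ℕ) : CktSize B2 (leafOut ℓ) (ℓ + 1) := by
  have h1 : CktSize B2 (fun (T : Fin 1 → Bool) (j : Fin ℓ) => (leafProg ℓ (T 0)).getD j false)
      (Fintype.card (Fin ℓ) * 1) :=
    CktSize.pi_const fun j => cktSize_apply_bool (fun b => (leafProg ℓ b).getD j false) 0
  have h2 := (cktSize_const (Fin 1) true).pair h1
  refine (h2.of_le (by simp; omega)).congr fun T t => ?_
  rcases t with u | j <;> rfl

/-! ### 6. Lemma 3.1: the binary tree of merge nodes -/

/-- The left half-block embedding. [folklore] -/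
def lHalf (h : ℕ) (i : Fin (2 ^ h)) : Fin (2 ^ (h + 1)) := ⟨i, by rw [pow_succ]; omega⟩

/-- The right half-block embedding. [folklore] -/
def rHalf (h : ℕ) (i : Fin (2 ^ h)) : Fin (2 ^ (h + 1)) := ⟨2 ^ h + i, by rw [pow_succ]; omega⟩

/-- **The tree** (Lemma 3.1 with arity `2`): the node of free width `h` and pattern `a` reads its
block of `2ʰ` bits; leaves output the leaf programs, inner nodes merge their two children.
[cite: MckayMurrayWilliams2019, Lemma 3.1] -/
def nodeSem (ℓ σ : ℕ) : (h : ℕ) → List Bool → (Fin (2 ^ h) → Bool) → Unit ⊕ Fin ℓ → Bool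
  | 0, _, T => leafOut ℓ T
  | h + 1, a, T => mergeOut ℓ h a σ (nodeSem ℓ σ h (false :: a) fun i => T (lHalf h i))
      (nodeSem ℓ σ h (true :: a) fun i => T (rHalf h i))

/-- The size of the tree of height `h`: leaves `SL`, merges `SM`. [folklore] -/
def treeSize (SL SM : ℕ) : ℕ → ℕ
  | 0 => SL
  | h + 1 => 2 * treeSize SL SM h + SM

/-- `treeSize h = 2ʰ · SL + (2ʰ - 1) · SM`. [folklore] -/
theorem treeSize_add (SL SM : ℕ) : ∀ h : ℕ, treeSize SL SM h + SM = 2 ^ h * (SL + SM)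
  | 0 => by simp [treeSize]
  | h + 1 => by
    have ih := treeSize_add SL SM h
    simp only [treeSize, pow_succ]
    nlinarith [ih]

/-- `treeSize h ≤ 2ʰ · (SL + SM)`. [folklore] -/
theorem treeSize_le (SL SM h : ℕ) : treeSize SL SM h ≤ 2 ^ h * (SL + SM) := by
  have := treeSize_add SL SM h; omega

section Tree

variable {q : Polynomial ℕ} (hq : ∀ n m : ℕ, CktSize B2 (lookupFn n m) (LB q n m))
include hq

/-- **Size of the tree** (MMW 2019, Lemma 3.1 and §5: `O(2ⁿ)` gates of `poly(s)` size each): with a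
uniform bound `SM` on the merge nodes of the levels below `n`, the node of free width `h` costs
`treeSize (ℓ + 1) SM h ≤ 2ʰ (ℓ + 1 + SM)` gates. [cite: MckayMurrayWilliams2019, Lemma 3.1] -/
theorem cktSize_nodeSem (ℓ σ n SM : ℕ)
    (hSM : ∀ (h : ℕ) (a : List Bool), h + 1 + a.length ≤ n → mergeSize q ℓ (zLen ℓ h a σ) ≤ SM) :
    ∀ (h : ℕ) (a : List Bool), h + a.length ≤ n → CktSize B2 (nodeSem ℓ σ h a) (treeSize (ℓ + 1) SM h)
  | 0, a, _ => (cktSize_leafOut ℓ).congr fun T t => rfl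
  | h + 1, a, hn => by
    have hL := (cktSize_nodeSem ℓ σ n SM hSM h (false :: a) (by simp; omega)).rewire (lHalf h)
    have hR := (cktSize_nodeSem ℓ σ n SM hSM h (true :: a) (by simp; omega)).rewire (rHalf h)
    have hM := (cktSize_mergeOut hq ℓ h a σ).of_le (hSM h a (by omega))
    have h1 := (hL.pair hR).comp hM
    refine (h1.of_le (by simp [treeSize]; omega)).congr fun T t => ?_
    simp only [nodeSem, Sum.elim_inl, Sum.elim_inr]

end Tree

/-! #### Splitting the block index -/

/-- `lowBits n i` is the bit function of `i`. [folklore] -/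
theorem lowBits_eq (n i : ℕ) : lowBits n i = fun k : Fin n => i.testBit k := funext (lowBits_apply n i)

/-- The low bits of an index of the doubled block: the low bits of the index in its half, then the
half bit. [folklore] -/
theorem ofFn_lowBits_succ (h i : ℕ) :
    List.ofFn (lowBits (h + 1) i) = List.ofFn (lowBits h i) ++ [i.testBit h] := by
  rw [lowBits_eq, lowBits_eq, List.ofFn_succ', List.concat_eq_append]
  rfl

/-- The low bits ignore the half bit. [folklore] -/
theorem lowBits_two_pow_add (h j : ℕ) : lowBits h (2 ^ h + j) = lowBits h j := by
  funext k
  rw [lowBits_apply, lowBits_apply, Nat.testBit_two_pow_add_gt k.2]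

/-- Index of the left half: low bits, then `0`. [folklore] -/
theorem ofFn_lowBits_lHalf (h : ℕ) (i : Fin (2 ^ h)) :
    List.ofFn (lowBits (h + 1) (lHalf h i)) = List.ofFn (lowBits h i) ++ [false] := by
  rw [show ((lHalf h i : Fin (2 ^ (h + 1))) : ℕ) = i from rfl, ofFn_lowBits_succ, Nat.testBit_lt_two_pow i.2]

/-- Index of the right half: low bits, then `1`. [folklore] -/
theorem ofFn_lowBits_rHalf (h : ℕ) (i : Fin (2 ^ h)) :
    List.ofFn (lowBits (h + 1) (rHalf h i)) = List.ofFn (lowBits h i) ++ [true] := by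
  rw [show ((rHalf h i : Fin (2 ^ (h + 1))) : ℕ) = 2 ^ h + i from rfl, ofFn_lowBits_succ,
    Nat.testBit_two_pow_add_eq, Nat.testBit_lt_two_pow i.2, lowBits_two_pow_add]
  rfl

/-- Every index of the doubled block is in one of the halves. [folklore] -/
theorem lHalf_or_rHalf (h : ℕ) (i : Fin (2 ^ (h + 1))) :
    (∃ j : Fin (2 ^ h), i = lHalf h j) ∨ (∃ j : Fin (2 ^ h), i = rHalf h j) := by
  by_cases hi : (i : ℕ) < 2 ^ h
  · exact Or.inl ⟨⟨i, hi⟩, Fin.ext rfl⟩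
  · refine Or.inr ⟨⟨i - 2 ^ h, ?_⟩, Fin.ext ?_⟩
    · have h1 := i.2
      have h2 : 2 ^ (h + 1) = 2 ^ h * 2 := pow_succ 2 h
      omega
    · simp [rHalf]; omega

/-- Every string is the low-bits listing of its own index in the cube order. [folklore] -/
theorem exists_ofFn_lowBits_eq (y : List Bool) : ∃ i : Fin (2 ^ y.length), List.ofFn (lowBits y.length i) = y := by
  refine ⟨boolFunEquivFin y.length y.get, ?_⟩
  rw [← boolFunEquivFin_symm_apply, Equiv.symm_apply_apply, List.ofFn_get]

/-! ### 7. Correctness of the tree -/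

/-- **Node invariant**: if the node reports success, its program is clean, small, and agrees with the
node's block of the truth table (input `y ++ a` ↦ bit `y` of the block).
[cite: MckayMurrayWilliams2019, Lemma 3.1 (proof)] -/
structure NodeOK (ℓ σ h : ℕ) (a : List Bool) (T : Fin (2 ^ h) → Bool) (out : Unit ⊕ Fin ℓ → Bool) : Prop where
  /-- the program is clean -/
  clean : isClean (List.ofFn fun j => out (.inr j)) = true
  /-- the program is small -/
  small : tabCount (List.ofFn fun j => out (.inr j)) ≤ σ
  /-- the program computes the block -/
  agree : ∀ i : Fin (2 ^ h),
    evalFn (boolPair (List.ofFn (lowBits h i) ++ a) (List.ofFn fun j => out (.inr j))) = [T i]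

/-- The program of a merge node that reports success is the greedy merge, and it is valid. [folklore] -/
theorem mergeOut_flag {ℓ h : ℕ} {a : List Bool} {σ : ℕ} {L R : Unit ⊕ Fin ℓ → Bool}
    (hf : mergeOut ℓ h a σ L R (.inl ()) = true) :
    L (.inl ()) = true ∧ R (.inl ()) = true ∧
      boolPair (codeZ h a σ (List.ofFn fun i => L (.inr i)) (List.ofFn fun i => R (.inr i))) [] ∈ EXT := by
  simp only [mergeOut, Sum.elim_inl, Bool.and_eq_true] at hf
  exact ⟨hf.1.1, hf.1.2, (boolIndicator_eq_true_iff' _ _).1 hf.2⟩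

/-- The program of a merge node. [folklore] -/
theorem ofFn_mergeOut_inr (ℓ h : ℕ) (a : List Bool) (σ : ℕ) (L R : Unit ⊕ Fin ℓ → Bool) :
    (List.ofFn fun j => mergeOut ℓ h a σ L R (.inr j)) =
      greedy (codeZ h a σ (List.ofFn fun i => L (.inr i)) (List.ofFn fun i => R (.inr i))) ℓ := by
  simp only [mergeOut, Sum.elim_inr]
  exact ofFn_getD_eq (length_greedy _ _)

/-- **Soundness of the tree** (MMW 2019, proof of Lemma 3.1, "if all circuits at layer `i` output a
valid circuit … then every circuit at layer `i + 1` will output a valid circuit"): a node reporting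
success holds a clean small program for its block. [cite: MckayMurrayWilliams2019, Lemma 3.1 (proof)] -/
theorem nodeSem_sound (ℓ σ : ℕ) (h6 : 6 ≤ ℓ) (he : 2 ∣ ℓ) (hσ : 1 ≤ σ) :
    ∀ (h : ℕ) (a : List Bool) (T : Fin (2 ^ h) → Bool),
      nodeSem ℓ σ h a T (.inl ()) = true → NodeOK ℓ σ h a T (nodeSem ℓ σ h a T)
  | 0, a, T, _ => by
    have hp : (List.ofFn fun j : Fin ℓ => nodeSem ℓ σ 0 a T (.inr j)) = leafProg ℓ (T 0) := by
      simp only [nodeSem, leafOut, Sum.elim_inr]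
      exact ofFn_getD_eq (length_leafProg h6 he _)
    refine ⟨by rw [hp, isClean_leafProg], by rw [hp, tabCount_leafProg]; exact hσ, fun i => ?_⟩
    rw [hp, evalFn_leafProg, Fin.fin_one_eq_zero i]
  | h + 1, a, T, hf => by
    simp only [nodeSem] at hf ⊢
    set L := nodeSem ℓ σ h (false :: a) fun i => T (lHalf h i) with hLdef
    set R := nodeSem ℓ σ h (true :: a) fun i => T (rHalf h i) with hRdef
    obtain ⟨hfL, hfR, hE⟩ := mergeOut_flag hf
    have okL := nodeSem_sound ℓ σ h6 he hσ h (false :: a) (fun i => T (lHalf h i)) hfL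
    have okR := nodeSem_sound ℓ σ h6 he hσ h (true :: a) (fun i => T (rHalf h i)) hfR
    rw [← hLdef] at okL
    rw [← hRdef] at okR
    have hV := isValidMerge_greedy h a σ _ _ hE
    rw [List.length_ofFn] at hV
    have hp := ofFn_mergeOut_inr ℓ h a σ L R
    refine ⟨by rw [hp]; exact hV.clean, by rw [hp]; exact hV.small, fun i => ?_⟩
    rw [hp]
    rcases lHalf_or_rHalf h i with ⟨j, rfl⟩ | ⟨j, rfl⟩
    · rw [ofFn_lowBits_lHalf, List.append_assoc, List.singleton_append,
        hV.agreeL _ (List.length_ofFn ..), okL.agree j]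
    · rw [ofFn_lowBits_rHalf, List.append_assoc, List.singleton_append,
        hV.agreeR _ (List.length_ofFn ..), okR.agree j]

/-- **Completeness of the tree** (MMW 2019, proof of Lemma 3.1: a small circuit for `T` "serves as
a witness for every Circuit-Min-Merge computation in the circuit"): if some clean program of length
`ℓ` with at most `σ` table instructions computes the block, the node reports success.
[cite: MckayMurrayWilliams2019, Lemma 3.1 (proof)] -/
theorem nodeSem_complete (ℓ σ : ℕ) (h6 : 6 ≤ ℓ) (he : 2 ∣ ℓ) (hσ : 1 ≤ σ) :
    ∀ (h : ℕ) (a : List Bool) (T : Fin (2 ^ h) → Bool),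
      (∃ D : List Bool, D.length = ℓ ∧ isClean D = true ∧ tabCount D ≤ σ ∧
        ∀ i : Fin (2 ^ h), evalFn (boolPair (List.ofFn (lowBits h i) ++ a) D) = [T i]) →
      nodeSem ℓ σ h a T (.inl ()) = true
  | 0, a, T, _ => rfl
  | h + 1, a, T, ⟨D, hDl, hDc, hDs, hD⟩ => by
    simp only [nodeSem]
    set L := nodeSem ℓ σ h (false :: a) fun i => T (lHalf h i) with hLdef
    set R := nodeSem ℓ σ h (true :: a) fun i => T (rHalf h i) with hRdef
    have hDL : ∀ i : Fin (2 ^ h), evalFn (boolPair (List.ofFn (lowBits h i) ++ false :: a) D) = [T (lHalf h i)] := by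
      intro i
      rw [← hD (lHalf h i), ofFn_lowBits_lHalf, List.append_assoc, List.singleton_append]
    have hDR : ∀ i : Fin (2 ^ h), evalFn (boolPair (List.ofFn (lowBits h i) ++ true :: a) D) = [T (rHalf h i)] := by
      intro i
      rw [← hD (rHalf h i), ofFn_lowBits_rHalf, List.append_assoc, List.singleton_append]
    have hfL : L (.inl ()) = true := nodeSem_complete ℓ σ h6 he hσ h (false :: a) _ ⟨D, hDl, hDc, hDs, hDL⟩
    have hfR : R (.inl ()) = true := nodeSem_complete ℓ σ h6 he hσ h (true :: a) _ ⟨D, hDl, hDc, hDs, hDR⟩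
    have okL := nodeSem_sound ℓ σ h6 he hσ h (false :: a) (fun i => T (lHalf h i)) hfL
    have okR := nodeSem_sound ℓ σ h6 he hσ h (true :: a) (fun i => T (rHalf h i)) hfR
    rw [← hLdef] at okL
    rw [← hRdef] at okR
    have hV : IsValidMerge h a σ (List.ofFn fun i => L (.inr i)) (List.ofFn fun i => R (.inr i)) D := by
      refine ⟨by rw [List.length_ofFn, hDl], hDc, hDs, fun y hy => ?_, fun y hy => ?_⟩
      · obtain ⟨i, hi⟩ := exists_ofFn_lowBits_eq y
        subst hy
        rw [← hi, hDL, okL.agree]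
      · obtain ⟨i, hi⟩ := exists_ofFn_lowBits_eq y
        subst hy
        rw [← hi, hDR, okR.agree]
    simp only [mergeOut, Sum.elim_inl, hfL, hfR, Bool.true_and]
    exact (boolIndicator_eq_true_iff' _ _).2 (nil_mem_EXT_of_isValidMerge hV)


/-! ### 8. The root: deciding `MCSP[s]` on truth tables of length `2ⁿ` -/

/-- **The program length** `ℓ = (σ + 1)(8(n + σ) + 10)`: even, at least `6`, and at least the length of
the program of every circuit of size `≤ σ` on `n` inputs (`length_progOf_le`). [folklore] -/
def ell (n σ : ℕ) : ℕ := (σ + 1) * (8 * (n + σ) + 10)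

/-- `ℓ ≥ 6`. [folklore] -/
theorem six_le_ell (n σ : ℕ) : 6 ≤ ell n σ := by
  unfold ell; nlinarith

/-- `ℓ` is even. [folklore] -/
theorem two_dvd_ell (n σ : ℕ) : 2 ∣ ell n σ :=
  ⟨(σ + 1) * (4 * (n + σ) + 5), by unfold ell; ring⟩

/-- Programs of circuits of size `≤ σ` fit in length `ℓ`. [folklore] -/
theorem length_progOf_le_ell {n σ : ℕ} (C : Circuit (Fin n)) (hC : C.size ≤ σ) : (progOf C).length ≤ ell n σ := by
  refine (length_progOf_le C).trans ?_
  unfold ell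
  exact Nat.mul_le_mul (by omega) (by omega)

/-- **The root decides `MCSP[s]` at length `2ⁿ`** (MMW 2019, proof of Lemma 3.1: the top gate outputs
`1` iff the truth table has a circuit of size `≤ s(n)`; soundness by Theorem R of
`CircuitEvalPrograms.lean`, completeness with the padded program of an optimal circuit).
[cite: MckayMurrayWilliams2019, Lemma 3.1 (proof)] -/
theorem root_iff (s : ℕ → ℕ) (n : ℕ) (hσ : 1 ≤ s n) (x : Fin (2 ^ n) → Bool) :
    nodeSem (ell n (s n)) (s n) n [] x (.inl ()) = true ↔ List.ofFn x ∈ MCSPSize s := by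
  have h6 := six_le_ell n (s n)
  have he := two_dvd_ell n (s n)
  constructor
  · intro hf
    have ok := nodeSem_sound (ell n (s n)) (s n) h6 he hσ n [] x hf
    set D := List.ofFn fun j => nodeSem (ell n (s n)) (s n) n [] x (.inr j) with hD
    obtain ⟨C, hB, hsize, hC⟩ := exists_circuit_evalFn n D ok.clean
    refine ⟨n, fun v => C.eval v, ?_, ?_⟩
    · apply List.ext_getElem (by simp)
      intro i h1 h2
      have hi : i < 2 ^ n := by simpa using h1
      have ha := ok.agree ⟨i, hi⟩
      rw [List.append_nil, hC] at ha
      rw [List.getElem_ofFn, getElem_truthTable]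
      simpa using ha.symm
    · exact (circuitSizeOver_le_of_computes C hB fun v => rfl).trans (hsize.trans (max_le ok.small hσ))
  · rintro ⟨n', f, hx, hf⟩
    have hn : n' = n := by
      have := congrArg List.length hx
      simp only [List.length_ofFn, length_truthTable] at this
      exact (Nat.pow_right_injective le_rfl this).symm
    subst hn
    obtain ⟨C₀, hB₀, -, hC₀⟩ := (cktSize_univ fun (v : Fin n' → Bool) (_ : Unit) => f v).toCircuit
    obtain ⟨C, hB, hCf, hCs⟩ := exists_circuit_size_eq_circuitSizeOver ⟨C₀, hB₀, hC₀⟩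
    have hsz : C.size ≤ s n' := hCs ▸ hf
    refine nodeSem_complete (ell n' (s n')) (s n') h6 he hσ n' [] x ⟨padProg (ell n' (s n')) C,
      length_padProg C (length_progOf_le_ell C hsz) he, isClean_padProg _ C,
      by rw [tabCount_padProg]; exact hsz, fun i => ?_⟩
    rw [List.append_nil, evalFn_padProg _ C hB, hCf]
    have h1 : (List.ofFn x)[(i : ℕ)]'(by simp) = (truthTable f)[(i : ℕ)]'(by simp) := by simp [hx]
    rw [List.getElem_ofFn, getElem_truthTable] at h1
    rw [← h1]

/-! ### 9. Polynomial bookkeeping -/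

/-- `IsPolyBd f`: `f(n, t) ≤ tᶜ` for some `c`, whenever `2 ≤ t` and `n ≤ t`. [folklore] -/
def IsPolyBd (f : ℕ → ℕ → ℕ) : Prop := ∃ c : ℕ, ∀ n t : ℕ, 2 ≤ t → n ≤ t → f n t ≤ t ^ c

/-- Constants are polynomially bounded. [folklore] -/
theorem IsPolyBd.const (k : ℕ) : IsPolyBd fun _ _ => k :=
  ⟨k, fun _ _ ht _ => (Nat.lt_two_pow_self).le.trans (Nat.pow_le_pow_left ht k)⟩

/-- `n` is polynomially bounded. [folklore] -/
theorem IsPolyBd.fst : IsPolyBd fun n _ => n := ⟨1, fun n t _ hn => by simpa using hn⟩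

/-- `t` is polynomially bounded. [folklore] -/
theorem IsPolyBd.snd : IsPolyBd fun _ t => t := ⟨1, fun n t _ _ => by simp⟩

/-- Sums of polynomially bounded functions. [folklore] -/
theorem IsPolyBd.add {f g : ℕ → ℕ → ℕ} (hf : IsPolyBd f) (hg : IsPolyBd g) : IsPolyBd fun n t => f n t + g n t := by
  obtain ⟨a, ha⟩ := hf
  obtain ⟨b, hb⟩ := hg
  refine ⟨max a b + 1, fun n t ht hn => ?_⟩
  have h1 : t ^ a ≤ t ^ max a b := Nat.pow_le_pow_right (by omega) (le_max_left a b)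
  have h2 : t ^ b ≤ t ^ max a b := Nat.pow_le_pow_right (by omega) (le_max_right a b)
  have h3 : t ^ (max a b + 1) = t ^ max a b * t := pow_succ t (max a b)
  have := ha n t ht hn
  have := hb n t ht hn
  nlinarith

/-- Products of polynomially bounded functions. [folklore] -/
theorem IsPolyBd.mul {f g : ℕ → ℕ → ℕ} (hf : IsPolyBd f) (hg : IsPolyBd g) : IsPolyBd fun n t => f n t * g n t := by
  obtain ⟨a, ha⟩ := hf
  obtain ⟨b, hb⟩ := hg
  refine ⟨a + b, fun n t ht hn => ?_⟩
  rw [pow_add]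
  exact Nat.mul_le_mul (ha n t ht hn) (hb n t ht hn)

/-- Powers of polynomially bounded functions. [folklore] -/
theorem IsPolyBd.pow {f : ℕ → ℕ → ℕ} (hf : IsPolyBd f) : ∀ k : ℕ, IsPolyBd fun n t => f n t ^ k
  | 0 => by simpa using IsPolyBd.const 1
  | k + 1 => by simpa [pow_succ] using (IsPolyBd.pow hf k).mul hf

/-- Polynomials of polynomially bounded functions. [folklore] -/
theorem IsPolyBd.eval (q : Polynomial ℕ) {f : ℕ → ℕ → ℕ} (hf : IsPolyBd f) : IsPolyBd fun n t => q.eval (f n t) := by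
  induction q using Polynomial.induction_on' with
  | add p q hp hq => simpa [Polynomial.eval_add] using hp.add hq
  | monomial k a => simpa [Polynomial.eval_monomial] using (IsPolyBd.const a).mul (hf.pow k)

/-- The program length is polynomially bounded. [folklore] -/
theorem isPolyBd_ell : IsPolyBd ell := by
  unfold ell
  exact (IsPolyBd.snd.add (IsPolyBd.const 1)).mul
    (((IsPolyBd.const 8).mul (IsPolyBd.fst.add IsPolyBd.snd)).add (IsPolyBd.const 10))

/-- A uniform bound on the length of the node data in the tree of height `n`. [folklore] -/
def M₀ (n σ : ℕ) : ℕ := 2 * (2 * ell n σ + 2 + ell n σ) + 2 + (2 * (2 * n + 2) + 2 + σ)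

/-- Node data are at most `M₀` long. [folklore] -/
theorem zLen_le_M₀ {n σ h : ℕ} {a : List Bool} (hn : h + 1 + a.length ≤ n) : zLen (ell n σ) h a σ ≤ M₀ n σ := by
  simp only [zLen, cLen, M₀]
  omega

/-- `M₀` is polynomially bounded. [folklore] -/
theorem isPolyBd_M₀ : IsPolyBd M₀ := by
  unfold M₀
  exact ((((IsPolyBd.const 2).mul ((((IsPolyBd.const 2).mul isPolyBd_ell).add (IsPolyBd.const 2)).add
    isPolyBd_ell)).add (IsPolyBd.const 2)).add ((((IsPolyBd.const 2).mul (((IsPolyBd.const 2).mul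
      IsPolyBd.fst).add (IsPolyBd.const 2))).add (IsPolyBd.const 2)).add IsPolyBd.snd))

/-- The look-up size is polynomially bounded in polynomially bounded block lengths. [folklore] -/
theorem isPolyBd_LB (q : Polynomial ℕ) {f g : ℕ → ℕ → ℕ} (hf : IsPolyBd f) (hg : IsPolyBd g) :
    IsPolyBd fun n t => LB q (f n t) (g n t) := by
  have h : IsPolyBd fun n t => 2 * f n t + 2 + g n t := ((((IsPolyBd.const 2).mul hf).add (IsPolyBd.const 2)).add hg)
  unfold LB
  exact h.add (IsPolyBd.eval q h)

/-- **The per-leaf budget `ℓ + 1 + mergeSize` of the tree is polynomially bounded in `(n, s(n))`.**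
[cite: MckayMurrayWilliams2019, §5 ("Replacing the oracle gates with poly(s(n)) size circuits")] -/
theorem isPolyBd_total (q : Polynomial ℕ) : IsPolyBd fun n σ => ell n σ + 1 + mergeSize q (ell n σ) (M₀ n σ) := by
  unfold mergeSize
  exact (isPolyBd_ell.add (IsPolyBd.const 1)).add (((IsPolyBd.const 2).mul isPolyBd_M₀).add
    ((((isPolyBd_LB q isPolyBd_M₀ (IsPolyBd.const 0)).add (IsPolyBd.const 2))).add
      (isPolyBd_ell.mul ((isPolyBd_LB q isPolyBd_M₀ (isPolyBd_ell.add (IsPolyBd.const 1))).add (IsPolyBd.const 2)))))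

/-! ### 10. The circuit family and the theorem -/

section Family

variable {q : Polynomial ℕ} (hq : ∀ n m : ℕ, CktSize B2 (lookupFn n m) (LB q n m))
include hq

/-- **The circuit for `MCSP[s]` at length `2ⁿ`** (`n ≥ 1`): the root flag of the tree, of size
`≤ 2ⁿ · (ℓ + 1 + mergeSize)`. [cite: MckayMurrayWilliams2019, Thm. 1.4 (third bullet), proof §5] -/
theorem cktSize_root (s : ℕ → ℕ) (n : ℕ) :
    CktSize B2 (fun (x : Fin (2 ^ n) → Bool) (_ : Unit) => nodeSem (ell n (s n)) (s n) n [] x (.inl ()))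
      (2 ^ n * (ell n (s n) + 1 + mergeSize q (ell n (s n)) (M₀ n (s n)))) := by
  have h := cktSize_nodeSem hq (ell n (s n)) (s n) n (mergeSize q (ell n (s n)) (M₀ n (s n)))
    (fun h a hn => mergeSize_mono q _ (zLen_le_M₀ hn)) n [] (by simp)
  exact (h.outMap fun _ : Unit => Sum.inl ()).of_le (treeSize_le _ _ _)

end Family

/-- `univBound N ≤ 16` for `N ≤ 2`. [folklore] -/
theorem univBound_le_sixteen {N : ℕ} (hN : N ≤ 2) : univBound N ≤ 16 := by
  have : univBound 2 = 16 := rfl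
  exact (univBound_mono hN).trans this.le

/-- `MCSP[s]` has no string whose length is not a power of two. [cite: KabanetsCai2000, §2] -/
theorem boolIndicator_MCSPSize_of_ne (s : ℕ → ℕ) {N : ℕ} (hN : ∀ m : ℕ, N ≠ 2 ^ m) (x : Fin N → Bool) :
    (MCSPSize s).boolIndicator (List.ofFn x) = false := by
  refine (Set.notMem_iff_boolIndicator _ _).1 ?_
  rintro ⟨m, f, hx, -⟩
  have := congrArg List.length hx
  simp only [List.length_ofFn, length_truthTable] at this
  exact hN m this

/-- **`NP ⊆ P/poly` puts `MCSP[s]` in `SIZE(N · s(⌊log₂ N⌋)^c + c)` for some `c`** (`s(n) ≥ n`): the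
contrapositive of MMW 2019, Thm. 1.4, third bullet, in the vendored form.
[cite: MckayMurrayWilliams2019, Thm. 1.4 (third bullet), proof §5] -/
theorem MCSPSize_mem_SIZE_of_NP_subset_PPoly (s : ℕ → ℕ) (hs : ∀ n, n ≤ s n) (hNP : NP ⊆ PPoly) :
    ∃ c : ℕ, MCSPSize s ∈ SIZE (fun N => N * s (Nat.log 2 N) ^ c + c) := by
  obtain ⟨q, hq⟩ := exists_lookup hNP
  obtain ⟨c, hc⟩ := isPolyBd_total q
  refine ⟨max c 16, ?_⟩
  -- one circuit per length
  have key : ∀ N : ℕ, ∃ C : Circuit (Fin N), C.IsOver B2 ∧ C.size ≤ N * s (Nat.log 2 N) ^ max c 16 + max c 16 ∧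
      ∀ x : Fin N → Bool, C.eval x = (MCSPSize s).boolIndicator (List.ofFn x) := by
    intro N
    by_cases hsmall : N ≤ 2
    · obtain ⟨C, hB, hs', hC⟩ :=
        (cktSize_univ fun (x : Fin N → Bool) (_ : Unit) => (MCSPSize s).boolIndicator (List.ofFn x)).toCircuit
      refine ⟨C, hB, hs'.trans ?_, hC⟩
      rw [Fintype.card_fin]
      exact (univBound_le_sixteen hsmall).trans ((le_max_right c 16).trans (Nat.le_add_left _ _))
    by_cases hp : N = 2 ^ Nat.log 2 N
    · set n := Nat.log 2 N with hn
      have h2n : 2 ≤ n := by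
        by_contra hlt
        have : N ≤ 2 := by
          rw [hp]
          calc 2 ^ n ≤ 2 ^ 1 := Nat.pow_le_pow_right (by norm_num) (by omega)
            _ = 2 := by norm_num
        exact hsmall this
      have hσ2 : 2 ≤ s n := h2n.trans (hs n)
      have hroot := (cktSize_root hq s n).rewire (ι' := Fin N) (Fin.cast hp.symm)
      obtain ⟨C, hB, hsz, hC⟩ := hroot.toCircuit
      refine ⟨C, hB, hsz.trans ?_, fun x => ?_⟩
      · calc 2 ^ n * (ell n (s n) + 1 + mergeSize q (ell n (s n)) (M₀ n (s n)))
            ≤ 2 ^ n * s n ^ c := Nat.mul_le_mul_left _ (hc n (s n) hσ2 (hs n))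
          _ ≤ N * s n ^ max c 16 := by
            rw [← hp]
            exact Nat.mul_le_mul_left _ (Nat.pow_le_pow_right (by omega) (le_max_left c 16))
          _ ≤ N * s n ^ max c 16 + max c 16 := Nat.le_add_right _ _
      · rw [hC]
        have hx : List.ofFn (fun i : Fin (2 ^ n) => x (Fin.cast hp.symm i)) = List.ofFn x := by
          apply List.ext_getElem (by simp [hp.symm])
          intro i h1 h2
          simp [Fin.cast]
        rw [Bool.eq_iff_iff, root_iff s n (by omega), boolIndicator_eq_true_iff', hx]
    · obtain ⟨C, hB, hs', hC⟩ := (cktSize_const (Fin N) false).toCircuit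
      refine ⟨C, hB, hs'.trans ((show 1 ≤ max c 16 by omega).trans (Nat.le_add_left _ _)), fun x => ?_⟩
      rw [hC, boolIndicator_MCSPSize_of_ne s (fun m hm => hp ?_) x]
      rw [hm, Nat.log_pow (by norm_num : 1 < 2)]
  choose C hB hsz hC using key
  refine ⟨C, fun N => ⟨hB N, hsz N⟩, fun w => ?_⟩
  have := hC w.length w.get
  rwa [List.ofFn_get] at this

end MMW19

/-- **McKay–Murray–Williams 2019, Theorem 1.4 (third bullet), discharged**: for every size parameter
`s(n) ≥ n`, if `MCSP[s] ∉ SIZE(N · s(⌊log₂ N⌋)^c + c)` for every `c`, then `NP ⊄ P/poly` — by the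
contrapositive `MMW19.MCSPSize_mem_SIZE_of_NP_subset_PPoly` (under `NP ⊆ P/poly` the Circuit-Min-Merge
tree of Lemma 3.1 with its gates replaced by `poly(s)`-size circuits decides `MCSP[s]` in size
`N · poly(s(n))`, §5). [cite: MckayMurrayWilliams2019, Thm. 1.4 (third bullet), proof §5 via Lemma 3.1] -/
theorem MckayMurrayWilliams2019_thm14_holds : MckayMurrayWilliams2019_thm14 :=
  fun s hs hlb hNP => (MMW19.MCSPSize_mem_SIZE_of_NP_subset_PPoly s hs hNP).elim fun c hc => hlb c hc

end Literature.Computability.MetaComplexity
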